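import Literature.AlgebraicGeometry.KTheory.HuComplexDimensionVanishing
import Literature.AlgebraicGeometry.KTheory.HuKZeroRationalInjectivity
import Literature.AlgebraicGeometry.Dimension.SmoothFibreDimension
import Literature.AlgebraicGeometry.Modules.CokernelSupport
import Literature.AlgebraicGeometry.Crystalline.DeRhamComplexHodgeSheaves
import Literature.Algebra.Homology.HyperExtTermwiseVanishing
import HarnessLib

/-!
# Vanishing of `ℍⁱ(p^{r,M}_{r,N}Ω•)` above `(r − 1) + d` on a smooth proper `W(k)`-model: supports

Sharpening of `KTheory/HuComplexDimensionVanishing` (vanishing above `r + d` from the cohomological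
dimension `d + 1` of `|𝒳|`) to X. Hu's printed range: for `k` perfect of characteristic `p` and
`𝒳/W(k)` smooth of relative dimension `d`, the complexes `p^{r,M}_{r,N}Ω•`
(`Crystalline.huComplexInt`) are supported on the special-fibre locus `V(p) = 𝒳 ∖ D(p)`, a closed
subset of dimension `≤ d`, so Grothendieck vanishing WITH SUPPORTS applies termwise:

* `compl_basicOpen_subset_preimage_closedPoint`, `compl_basicOpen_eq_preimage_closedPoint`,
  `sdim_compl_basicOpen_le` — `V(p)` is the fibre of `𝒳 → Spec W(k)` over the closed point, hence
  `sdim V(p) ≤ d`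
  (`Dimension.sdim_preimage_singleton_le`: fibres of a morphism smooth of relative dimension `d`);
* `isSupportedOn_deRhamReduction_X`, `isSupportedOn_huComplex_X`, `isSupportedOn_huComplexInt_X` —
  the terms `Ωʲ/p^{(r−j)N}` of the staircase reduction and the terms `p^{(r−j)M}Ωʲ/p^{(r−j)N}` of Hu's
  complex are supported on `V(p)` (they are quotients / subquotients of the `𝒪_𝒳`-MODULE `Ωʲ_{𝒳/W}`
  killed by a power of `p`: `Modules.isSupportedOn_of_epi_of_zsmul_id_eq_zero` with the
  identification `Crystalline.algebraicDeRhamComplexXIso : (Ω•)ʲ ≅ (Ωʲ)^{ab}` and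
  `KTheory.zsmul_id_powQuotient_X`);
* `huH_eq_zero_of_isSmoothProperModel'` — **`ℍⁱ(|𝒳|, p^{r,M}_{r,N}Ω•) = 0` for `i > (r − 1) + d`**
  (`Algebra.Homology.HyperExt.eq_zero_of_termwise` fed with
  `Motives.GrothendieckVanishingProof.vanishingOn` on `V(p)`), the step "For `r ≥ d + i`,
  `H^{2r−i−j}(X_1, p^{r,m}_{r,n}Ωʲ)` vanishes because `2r − i − j ≥ r + 1 − i ≥ d + 1`" of the proof of
  Prop. 11.1 of arXiv:2507.12458 (p. 65) in its printed strength (caveat (β) of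
  `KTheory/HuInfinitesimalKZero`: hypercohomology on `|𝒳|` versus `|X_1|` — the supports argument
  recovers the `|X_1|`-bound);
* consequences for the carriers of `HuKZeroKernelPresentation`: the components `r > d` of
  `⊕_{r=1}^{p−1} ℍ^{2r−1}(p^{r,m}_{r,n}Ω•)` vanish (`HuKernelSource.apply_eq_zero_of_lt'`), the odd level
  transitions are onto for `d < r` (`huHReduce_odd_surjective_of_lt'`), and the reduction of kernel
  sources is onto as soon as it is onto on the components `r ≤ d`
  (`HuKernelSource.reduce_surjective_of_le'`); and at the boundary `r = d` (indeed for all `d ≤ r`)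
  the odd transition is still onto, because by the long exact sequence of Hu's three-term sequence its
  failure is measured inside `ℍ^{2r}(p^{r,M}_{r,N}Ω•) = 0` (`huHReduce_odd_surjective_of_dim_le`,
  `HuKernelSource.reduce_surjective_of_lt_dim`) — the lattice statement (S) of crux
  `FormalLiftingFromClassLifting` (route `HodgeConjecture/PadicSemiregularLift`) is thus needed only
  for `1 ≤ r < d`, the range of Hu's obstruction target `⊕_{r=1}^{d−1} ℍ^{2r}`
  (`odd_transitions_surjective_of_lt_dim` states this in the consumer's exact shape).

## References

* X. Hu, *On the algebraic K-theory of smooth schemes over truncated Witt vectors*,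
  arXiv:2507.12458 (2025), Cor. 10.5 (i) (p. 52), proof of Prop. 11.1 (p. 65). [Hu2025TruncatedWitt]
* R. Hartshorne, *Algebraic Geometry* (1977), III Thm. 2.7 with III.2.10 (Grothendieck vanishing,
  cohomology with supports in a closed subset). [Hartshorne1977]
-/

noncomputable section

universe u

open CategoryTheory CategoryTheory.Limits Opposite _root_.AlgebraicGeometry _root_.TopologicalSpace

/-! ### The special-fibre locus `V(p)` of a `W(k)`-scheme -/

namespace Literature.AlgebraicGeometry.Motives.WittScheme

variable {p : ℕ} [Fact p.Prime] {k : Type u} [Field k] [CharP k p] [PerfectRing k p]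

/-- **`V(p)` lies over the closed point**: for a `W(k)`-scheme `𝒳` (`k` perfect of characteristic
`p`), the zero locus `𝒳 ∖ D(p)` of `p ∈ Γ(𝒳, 𝒪)` is contained in the preimage of the closed point of
`Spec W(k)` (indeed equal to it): `𝒳 ∖ D(p) = f⁻¹(Spec W ∖ D(p))`
(`Modules.compl_basicOpen_intCast_eq_preimage`) and the only prime of the discrete valuation ring
`W(k)` containing `p ≠ 0` is the maximal ideal. [folklore] -/
theorem compl_basicOpen_subset_preimage_closedPoint (𝒳 : SchemeOver (WittVector p k)) :
    ((𝒳.left.basicOpen (p : Γ(𝒳.left, ⊤)) : Set 𝒳.left))ᶜ ⊆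
      𝒳.hom.base ⁻¹' {IsLocalRing.closedPoint (WittVector p k)} := by
  have h := Modules.compl_basicOpen_intCast_eq_preimage 𝒳.hom (p : ℤ)
  simp only [Int.cast_natCast] at h
  rw [h]
  refine Set.preimage_mono fun 𝔭 h𝔭 => ?_
  rw [Set.mem_compl_iff, SetLike.mem_coe, AlgebraicGeometry.basicOpen_eq_of_affine', map_natCast]
    at h𝔭
  -- `h𝔭 : 𝔭 ∉ D(p)`, i.e. `p ∈ 𝔭`
  have hp𝔭 : (p : WittVector p k) ∈ 𝔭.asIdeal := by
    by_contra hcon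
    exact h𝔭 ((PrimeSpectrum.mem_basicOpen _ _).mpr hcon)
  have hne : 𝔭.asIdeal ≠ ⊥ := fun h0 => by
    rw [h0, Ideal.mem_bot] at hp𝔭
    exact WittVector.p_nonzero p k hp𝔭
  exact PrimeSpectrum.ext (IsLocalRing.eq_maximalIdeal (𝔭.isPrime.isMaximal_of_ne_bot hne))

/-- **`V(p)` IS the fibre over the closed point**: equality in
`compl_basicOpen_subset_preimage_closedPoint` (conversely `p` lies in the maximal ideal of `W(k)`,
being irreducible, Mathlib `WittVector.irreducible`, so the closed point is not in `D(p)`). [folklore] -/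
theorem compl_basicOpen_eq_preimage_closedPoint (𝒳 : SchemeOver (WittVector p k)) :
    ((𝒳.left.basicOpen (p : Γ(𝒳.left, ⊤)) : Set 𝒳.left))ᶜ =
      𝒳.hom.base ⁻¹' {IsLocalRing.closedPoint (WittVector p k)} := by
  refine Set.Subset.antisymm (compl_basicOpen_subset_preimage_closedPoint 𝒳) ?_
  have h := Modules.compl_basicOpen_intCast_eq_preimage 𝒳.hom (p : ℤ)
  simp only [Int.cast_natCast] at h
  rw [h]
  refine Set.preimage_mono fun 𝔭 h𝔭 => ?_
  obtain rfl : 𝔭 = IsLocalRing.closedPoint (WittVector p k) := h𝔭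
  rw [Set.mem_compl_iff, SetLike.mem_coe, AlgebraicGeometry.basicOpen_eq_of_affine', map_natCast]
  intro hmem
  exact (PrimeSpectrum.mem_basicOpen _ _).mp hmem
    ((IsLocalRing.mem_maximalIdeal _).mpr (mem_nonunits_iff.mpr (WittVector.irreducible p).not_isUnit))

/-- **`sdim V(p) ≤ d`** for a `W(k)`-scheme smooth of relative dimension `d` (`k` perfect of
characteristic `p`): `V(p)` lies in the fibre over the closed point, of `sdim ≤ d`
(`Dimension.sdim_preimage_singleton_le`). [folklore] -/
theorem sdim_compl_basicOpen_le (d : ℕ) (𝒳 : SchemeOver (WittVector p k))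
    [SmoothOfRelativeDimension d 𝒳.hom] :
    sdim ((𝒳.left.basicOpen (p : Γ(𝒳.left, ⊤)) : Set 𝒳.left))ᶜ ≤ d :=
  (sdim_mono (compl_basicOpen_subset_preimage_closedPoint 𝒳)).trans
    (Dimension.sdim_preimage_singleton_le 𝒳.hom d _)

end Literature.AlgebraicGeometry.Motives.WittScheme

/-! ### Supports of the terms of Hu's complexes -/

namespace Literature.AlgebraicGeometry.KTheory

open Literature.AlgebraicGeometry.Motives Literature.AlgebraicGeometry.Motives.WittScheme
  Literature.AlgebraicGeometry.Crystalline Literature.Algebra.Homology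

section Supports

variable {A : Type u} [CommRing A] (X : Over (Spec (CommRingCat.of A))) (q : ℕ)

/-- A zero abelian sheaf is supported on every subset. [folklore] -/
theorem isSupportedOn_of_isZero {T : TopCat.{u}}
    {F G : Sheaf (Opens.grothendieckTopology T) AddCommGrpCat.{u}} (hF : IsZero F) {Y : Set T}
    (hG : IsSupportedOn G Y) : IsSupportedOn F Y :=
  haveI := hF.mono (0 : F ⟶ G)
  hG.of_mono (0 : F ⟶ G)

/-- **The terms `Ωʲ/q^{(r−j)N}` of the staircase reduction are supported on `V(q)`**: the `j`-th term
is the cokernel of `q^{(r−j)N} • 𝟙` on `(Ω•_{X/A})ʲ ≅ (Ωʲ_{X/A})^{ab}`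
(`Crystalline.algebraicDeRhamComplexXIso`), the abelian sheaf of an `𝒪_X`-module, and it is killed by
`q^{(r−j)N}` (`KTheory.zsmul_id_powQuotient_X`), so `Modules.isSupportedOn_of_epi_of_zsmul_id_eq_zero`
applies. [folklore] -/
theorem isSupportedOn_deRhamReduction_X (r N j : ℕ) :
    IsSupportedOn ((deRhamReduction X (q : ℤ) r N).X j)
      ((X.left.basicOpen (q : Γ(X.left, ⊤)) : Set X.left))ᶜ := by
  let π : (SheafOfModules.toSheaf X.left.ringCatSheaf).obj (hodgeSheaf X j) ⟶
      (deRhamReduction X (q : ℤ) r N).X j :=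
    (algebraicDeRhamComplexXIso X j).inv ≫
      cokernel.π (powSMul (algebraicDeRhamComplex X) (q : ℤ) (fun i => (r - i) * N) j)
  haveI : Epi π := epi_comp _ _
  have h := Modules.isSupportedOn_of_epi_of_zsmul_id_eq_zero (hodgeSheaf X j) π (q : ℤ)
    ((r - j) * N) (zsmul_id_powQuotient_X (algebraicDeRhamComplex X) (q : ℤ)
      (antitone_staircase r N) j)
  simpa only [Int.cast_natCast] using h

/-- **The terms `q^{(r−j)M}Ωʲ/q^{(r−j)N}` of Hu's complex `p^{r,M}_{r,N}Ω•` are supported on `V(q)`**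
(subsheaves of the terms of the staircase reduction). [folklore] -/
theorem isSupportedOn_huComplex_X (r M N j : ℕ) :
    IsSupportedOn ((huComplex X (q : ℤ) r M N).X j)
      ((X.left.basicOpen (q : Γ(X.left, ⊤)) : Set X.left))ᶜ :=
  (isSupportedOn_deRhamReduction_X X q r N j).of_mono
    (image.ι (powSMul (deRhamReduction X (q : ℤ) r N) (q : ℤ) (fun i => (r - i) * M) j))

/-- Every term of the `ℤ`-indexed Hu complex `p^{r,M}_{r,N}Ω•` (`Crystalline.huComplexInt`) is
supported on `V(q)` (the terms in negative degrees are zero). [folklore] -/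
theorem isSupportedOn_huComplexInt_X (r M N : ℕ) (i : ℤ) :
    IsSupportedOn ((huComplexInt X (q : ℤ) r M N).X i)
      ((X.left.basicOpen (q : Γ(X.left, ⊤)) : Set X.left))ᶜ := by
  cases i with
  | ofNat j =>
    exact (isSupportedOn_huComplex_X X q r M N j).of_mono
      ((huComplex X (q : ℤ) r M N).extendXIso ComplexShape.embeddingUpNat (i := j) rfl).hom
  | negSucc j =>
    exact isSupportedOn_of_isZero
      ((huComplex X (q : ℤ) r M N).isZero_extend_X ComplexShape.embeddingUpNat _
        (fun i hi => by simp at hi))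
      (isSupportedOn_huComplex_X X q r M N 0)

end Supports

/-! ### Vanishing above `(r − 1) + d` -/

section Vanishing

variable {p : ℕ} [Fact p.Prime] {k : Type} [Field k] [CharP k p] [PerfectRing k p]
  {d : ℕ} {𝒳 : SchemeOver (WittVector p k)}

/-- **Vanishing above `(r − 1) + d`**: on a smooth proper model `𝒳/W(k)` of relative dimension `d`,
`ℍⁱ(|𝒳|, p^{r,M}_{r,N}Ω•) = 0` for `i > (r − 1) + d` — the terms of the complex (in degrees
`[0, r − 1]`) are supported on the special-fibre locus `V(p)` of `sdim ≤ d`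
(`sdim_compl_basicOpen_le`), so each has `Hⁱ = 0` for `i > d` (Grothendieck vanishing with supports,
`Motives.GrothendieckVanishingProof.vanishingOn`), and the termwise bound propagates to
hypercohomology (`Algebra.Homology.HyperExt.eq_zero_of_termwise`). This is the printed dimension step
of the proof of Prop. 11.1 of arXiv:2507.12458, p. 65 ("For `r ≥ d + i`,
`H^{2r−i−j}(X_1, p^{r,m}_{r,n}Ωʲ_{X•})` vanishes because `2r − i − j ≥ r + 1 − i ≥ d + 1`"), now in the
same range as on `|X_1|`. [cite: Hu2025TruncatedWitt, proof of Prop. 11.1 (p. 65)] -/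
theorem huH_eq_zero_of_isSmoothProperModel' (h : IsSmoothProperModel d 𝒳) (r M N : ℕ) {i : ℤ}
    (hi : (r : ℤ) - 1 + d < i) (x : huH p k 𝒳 r M N i) : x = 0 := by
  haveI := h.noetherianSpace
  haveI := h.smoothOfRelativeDimension
  refine HyperExt.eq_zero_of_termwise (hA := fun n Y => hasHyperExt_of_isGE _ _ n)
    (constantSheafInt (Opens.grothendieckTopology 𝒳.left)) (huComplexInt 𝒳 (p : ℤ) r M N)
    ((r : ℤ) - 1) d (fun j i' hi' y => ?_) hi x
  haveI : Subsingleton (((huComplexInt 𝒳 (p : ℤ) r M N).X j).H i') :=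
    GrothendieckVanishingProof.vanishingOn (X := 𝒳.left.carrier)
      ⟨((𝒳.left.basicOpen (p : Γ(𝒳.left, ⊤)) : Set 𝒳.left))ᶜ,
        Modules.isClosed_compl_basicOpen (p : Γ(𝒳.left, ⊤))⟩
      _ (isSupportedOn_huComplexInt_X 𝒳 p r M N j) i'
      (lt_of_le_of_lt (sdim_compl_basicOpen_le d 𝒳) (by exact_mod_cast hi'))
  exact Subsingleton.elim _ _

/-- `ℍⁱ(p^{r,M}_{r,N}Ω•)` of a smooth proper model of relative dimension `d` is trivial for
`i > (r − 1) + d`. [cite: Hu2025TruncatedWitt, proof of Prop. 11.1 (p. 65)] -/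
theorem subsingleton_huH_of_isSmoothProperModel' (h : IsSmoothProperModel d 𝒳) (r M N : ℕ)
    {i : ℤ} (hi : (r : ℤ) - 1 + d < i) : Subsingleton (huH p k 𝒳 r M N i) :=
  ⟨fun x y => by rw [huH_eq_zero_of_isSmoothProperModel' h r M N hi x,
    huH_eq_zero_of_isSmoothProperModel' h r M N hi y]⟩

/-- **The components `r > d` of Hu's kernel source vanish** on a smooth proper model of relative
dimension `d`: for `x ∈ ⊕_{r=1}^{p−1} ℍ^{2r−1}(p^{r,m}_{r,n}Ω•)` (`KTheory.HuKernelSource`), `x_r = 0`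
whenever `d < r` (`2r − 1 > (r − 1) + d`) — the sum in Cor. 10.5 (i) of arXiv:2507.12458 is effectively
over `1 ≤ r ≤ min(p − 1, d)`. [cite: Hu2025TruncatedWitt, Cor. 10.5 (i) (p. 52) and proof of Prop. 11.1 (p. 65)] -/
theorem HuKernelSource.apply_eq_zero_of_lt' (h : IsSmoothProperModel d 𝒳) {m n : ℕ}
    (x : HuKernelSource p k 𝒳 m n) (r : {r : ℕ // 1 ≤ r ∧ r < p}) (hr : d < r.1) : x r = 0 :=
  huH_eq_zero_of_isSmoothProperModel' h r.1 m n (by omega) (x r)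

/-- Two elements of Hu's kernel source on a smooth proper model of relative dimension `d` agree as
soon as their components `r ≤ d` agree. [cite: Hu2025TruncatedWitt, Cor. 10.5 (i) (p. 52)] -/
theorem HuKernelSource.ext_of_le' (h : IsSmoothProperModel d 𝒳) {m n : ℕ}
    {x y : HuKernelSource p k 𝒳 m n}
    (hxy : ∀ r : {r : ℕ // 1 ≤ r ∧ r < p}, r.1 ≤ d → x r = y r) : x = y := by
  funext r
  by_cases hr : r.1 ≤ d
  · exact hxy r hr
  · rw [HuKernelSource.apply_eq_zero_of_lt' h x r (lt_of_not_ge hr),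
      HuKernelSource.apply_eq_zero_of_lt' h y r (lt_of_not_ge hr)]

/-- In degrees `i > (r − 1) + d` the level reductions `ℍⁱ(p^{r,M}_{r,N'}Ω•) → ℍⁱ(p^{r,M}_{r,N}Ω•)` are
(trivially) surjective. [cite: Hu2025TruncatedWitt, Cor. 10.5 (i) (p. 52)] -/
theorem huHReduce_surjective_of_lt' (h : IsSmoothProperModel d 𝒳) (r M : ℕ) {N N' : ℕ}
    (hN : N ≤ N') {i : ℤ} (hi : (r : ℤ) - 1 + d < i) :
    Function.Surjective (huHReduce p k 𝒳 r M hN i) := fun y =>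
  ⟨0, by rw [map_zero]; exact (huH_eq_zero_of_isSmoothProperModel' h r M N hi y).symm⟩

/-- **The odd transitions are onto for `d < r`**: the reduction
`ℍ^{2r−1}(p^{r,M}_{r,N'}Ω•) → ℍ^{2r−1}(p^{r,M}_{r,N}Ω•)` is surjective whenever `d < r`; the lattice
statement "(S) odd transitions are onto" accompanying `HuKZeroKernelPresentation` in crux
`FormalLiftingFromClassLifting` of route `HodgeConjecture/PadicSemiregularLift` is therefore needed
only for `1 ≤ r ≤ d`. [cite: Hu2025TruncatedWitt, Cor. 10.5 (i) (p. 52)] -/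
theorem huHReduce_odd_surjective_of_lt' (h : IsSmoothProperModel d 𝒳) {r : ℕ} (hr : d < r)
    (M : ℕ) {N N' : ℕ} (hN : N ≤ N') :
    Function.Surjective (huHReduce p k 𝒳 r M hN (2 * (r : ℤ) - 1)) :=
  huHReduce_surjective_of_lt' h r M hN (by omega)

/-- Product form: the level reduction of Hu's kernel sources (`KTheory.HuKernelSource.reduce`) is
surjective as soon as it is surjective on the components `r ≤ d`.
[cite: Hu2025TruncatedWitt, Cor. 10.5 (i) (p. 52)] -/
theorem HuKernelSource.reduce_surjective_of_le' (h : IsSmoothProperModel d 𝒳) (m : ℕ) {n n' : ℕ}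
    (hn : n ≤ n')
    (hS : ∀ r : {r : ℕ // 1 ≤ r ∧ r < p}, r.1 ≤ d →
      Function.Surjective (huHReduce p k 𝒳 r.1 m hn (2 * (r.1 : ℤ) - 1))) :
    Function.Surjective (HuKernelSource.reduce (p := p) (k := k) (𝒳 := 𝒳) m hn) := by
  intro y
  have hcomp : ∀ r : {r : ℕ // 1 ≤ r ∧ r < p}, ∃ x : huH p k 𝒳 r.1 m n' (2 * (r.1 : ℤ) - 1),
      huHReduce p k 𝒳 r.1 m hn _ x = y r := fun r => by
    by_cases hr : r.1 ≤ d
    · exact hS r hr (y r)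
    · exact huHReduce_odd_surjective_of_lt' h (lt_of_not_ge hr) m hn (y r)
  choose x hx using hcomp
  exact ⟨x, funext fun r => hx r⟩

/-! ### The boundary case `r = d`: the odd transition is still onto -/

/-- **The odd transitions are onto already for `d ≤ r`.** For `M' ≤ M ≤ N` the reduction
`ℍ^{2r−1}(p^{r,M'}_{r,N}Ω•) → ℍ^{2r−1}(p^{r,M'}_{r,M}Ω•)` is surjective iff
`ℍ^{2r}(p^{r,M}_{r,N}Ω•) → ℍ^{2r}(p^{r,M'}_{r,N}Ω•)` is injective (the long exact sequence of Hu's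
three-term sequence `0 → p^{r,M}_{r,N} → p^{r,M'}_{r,N} → p^{r,M'}_{r,M} → 0`,
`KTheory.huHReduce_surjective_iff_map_injective`), and for `d ≤ r` the source
`ℍ^{2r}(p^{r,M}_{r,N}Ω•)` of the latter map is ZERO (`2r > (r − 1) + d`,
`subsingleton_huH_of_isSmoothProperModel'`). So on a smooth proper model of relative dimension `d`
the lattice statement "(S) odd transitions are onto" accompanying `HuKZeroKernelPresentation` is
needed only for `1 ≤ r < d` — the same range as Hu's Hodge obstruction target
`⊕_{r=1}^{d−1} ℍ^{2r}` (`KTheory.HuObstructionTarget`). [cite: Hu2025TruncatedWitt, Cor. 10.5 (i) (p. 52) and Def. 8.2–8.3 (p. 38)] -/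
theorem huHReduce_odd_surjective_of_dim_le (h : IsSmoothProperModel d 𝒳) {r : ℕ} (hr : d ≤ r)
    {M M' N : ℕ} (hM : M' ≤ M) (hN : M ≤ N) :
    Function.Surjective (huHReduce p k 𝒳 r M' hN (2 * (r : ℤ) - 1)) := by
  rw [huHReduce_surjective_iff_map_injective p k 𝒳 r hM hN (2 * (r : ℤ) - 1) (2 * (r : ℤ))
    (by ring)]
  haveI := subsingleton_huH_of_isSmoothProperModel' h r M N (i := 2 * (r : ℤ)) (by omega)
  exact fun a b _ => Subsingleton.elim a b

/-- **Product form, final range.** For `m ≤ n ≤ n'` the level reduction of Hu's kernel sources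
`⊕_{r=1}^{p−1} ℍ^{2r−1}(p^{r,m}_{r,n'}Ω•) → ⊕_{r=1}^{p−1} ℍ^{2r−1}(p^{r,m}_{r,n}Ω•)`
(`KTheory.HuKernelSource.reduce`) on a smooth proper model of relative dimension `d` is surjective as
soon as it is surjective on the components `1 ≤ r < d` (the components `r ≥ d` are onto by
`huHReduce_odd_surjective_of_dim_le`). In the kernel-tower use of `HuKZeroKernelPresentation`
(`m = 1`, levels `N + 3 → N + 2`) this leaves exactly the range of the obstruction target.
[cite: Hu2025TruncatedWitt, Cor. 10.5 (i) (p. 52)] -/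
theorem HuKernelSource.reduce_surjective_of_lt_dim (h : IsSmoothProperModel d 𝒳) {m n n' : ℕ}
    (hmn : m ≤ n) (hn : n ≤ n')
    (hS : ∀ r : {r : ℕ // 1 ≤ r ∧ r < p}, r.1 < d →
      Function.Surjective (huHReduce p k 𝒳 r.1 m hn (2 * (r.1 : ℤ) - 1))) :
    Function.Surjective (HuKernelSource.reduce (p := p) (k := k) (𝒳 := 𝒳) m hn) := by
  intro y
  have hcomp : ∀ r : {r : ℕ // 1 ≤ r ∧ r < p}, ∃ x : huH p k 𝒳 r.1 m n' (2 * (r.1 : ℤ) - 1),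
      huHReduce p k 𝒳 r.1 m hn _ x = y r := fun r => by
    by_cases hr : r.1 < d
    · exact hS r hr (y r)
    · exact huHReduce_odd_surjective_of_dim_le h (le_of_not_gt hr) hmn hn (y r)
  choose x hx using hcomp
  exact ⟨x, funext fun r => hx r⟩

/-- **The consumer's hypothesis (S), assembled.** On a smooth proper model of relative dimension `d`,
the family of odd level transitions
`ℍ^{2r−1}(p^{r,1}_{r,N+3}Ω•) → ℍ^{2r−1}(p^{r,1}_{r,N+2}Ω•)`, `1 ≤ r < p`, `N ≥ 0` — hypothesis `hS` of
`kernelTower_of_huKernelPresentation_of_components` in crux `FormalLiftingFromClassLifting` of route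
`HodgeConjecture/PadicSemiregularLift`, stated here in exactly that shape — is onto as soon as it is
onto for `1 ≤ r < d` (`huHReduce_odd_surjective_of_dim_le` supplies `d ≤ r`).
[cite: Hu2025TruncatedWitt, Cor. 10.5 (i) (p. 52)] -/
theorem odd_transitions_surjective_of_lt_dim (h : IsSmoothProperModel d 𝒳)
    (hS : ∀ (N r : ℕ), 1 ≤ r → r < d →
      Function.Surjective (huHReduce p k 𝒳 r 1 (Nat.le_succ (N + 2)) (2 * (r : ℤ) - 1))) :
    ∀ (N r : ℕ), 1 ≤ r → r < p →
      Function.Surjective (huHReduce p k 𝒳 r 1 (Nat.le_succ (N + 2)) (2 * (r : ℤ) - 1)) := by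
  intro N r hr _
  by_cases hrd : r < d
  · exact hS N r hr hrd
  · exact huHReduce_odd_surjective_of_dim_le h (le_of_not_gt hrd) (by omega) (Nat.le_succ (N + 2))

end Vanishing

end Literature.AlgebraicGeometry.KTheory

end
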